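import Literature.IUT.HodgeTheaters.PuncturedEllipticCoveringsCuspsProofs
import Literature.IUT.HodgeTheaters.PuncturedEllipticCoveringsSplitting
import Literature.IUT.HodgeTheaters.PuncturedEllipticCoveringsXbarRecovery
import HarnessLib

/-!
# [IUTchI] Corollary 1.2, proof p. 39: transport of cusps along a core isomorphism and
# `Θ(Π_C̲) = Π'_C̲` — proof-only kernels

Mochizuki, *Inter-universal Teichmüller theory I*, kurims manuscript (May 2020), §1, Corollary 1.2
"Characteristic Nature of Coverings", PROOF p. 39 ([IUTchI] Cor 1.2 p.39)
[claim: Mochizuki2012, status: disputed].  Node `IUTchI:Cor1.2`; proof-only companion (no definitions,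
nothing restated) over abc-iut-L5-t1's FROZEN `PuncturedEllipticCoverings.lean`, `…Cusps.lean`
(`CuspGalois`), `…CuspsProofs.lean`, and the abc-iut-L5-d4 kernels `…Characteristic` (p405757),
`…CuspRecovery` (p424465), `…Splitting` (p425983), `…XbarRecovery` (p429979).

SETTING.  `Θ : Π_C ⥲ Π'_C` is an isomorphism of the cores [as produced on p. 39 by slimness,
[AbsTopI] Thm. 2.6 (v)(vi) and [AbsTopII] Cor. 3.3 (i)(ii): "reconstruct `Π_C` [together with the
natural inclusion `Π_{X̲→} ↪ Π_C`], as well as the subgroups `Δ_X ⊆ Δ_C ⊆ Π_C`"] carrying `Π_{X̲→}`,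
`Δ_X`, `Δ_C` onto their counterparts; the cuspidal decomposition groups correspond under `Θ` up to
`Π'_X̲`-conjugacy, `Θ(D_x) = t'·D'_{x'}·t'⁻¹` [[AbsTopI] Lem. 4.5 with Rmk. 1.2.2 (ii)] — all of this
enters ONLY as hypotheses of implications, never asserted.  KERNELS (pure group theory):
* `piX_eq_piXbar_sup_deltaX` (`Π_X = Π_X̲·Δ_X`, UNCONDITIONAL), `map_piX_eq` (`Θ(Π_X) = Π'_X`),
  `ArrowCoveringClaims.index_piCbar` (`[Π_C : Π_C̲] = l`), `ArrowCoveringClaims.conj_smul_piXarrow`;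
* the correspondence `Θ(D_x) ∼ D'_{x'}` is FUNCTIONAL and INJECTIVE (`cusp_eq_of_map_decomp_eq`,
  `cusp_eq_of_map_decomp_eq'`), INTERTWINES the cusp actions (`map_decomp_act`: `Θ(D_{g·x}) ∼
  D'_{Θ(g)·x'}`) and the ramification criterion "image in `Gal(X̲→/X̲)` nontrivial"
  (`not_inertia_le_iff_of_map_decomp`), hence respects the ramified triple `{ε⁰, ε′, ε″}`
  (`mem_triple_iff_of_map_decomp`; the clause `¬ I_{ε⁰} ⊆ Π_{X̲→}` for the zero cusp is PRINTED on p. 39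
  but not among the frozen `ArrowCoveringClaims`, so it is the binder `h0`/`h0'`, no new `Prop`);
* **`ArrowCoveringClaims.map_piCbar_eq_of_cusps`: `Θ(Π_C̲) = Π'_C̲`** — an element of `Θ(Π_C̲) ∖ Π'_X`
  stabilises `{ε⁰', ε′', ε″'}`, hence lies in `Π'_C̲` by "the unique splitting that stabilizes …"
  (`mem_piCbar_of_act_stabilizes`, p425983), and `[Π_C : Π_C̲] = l = l' = [Π'_C : Π'_C̲]`
  (`l_eq_of_map_deltaC`, `Π_X̲ = Π_{X̲→}·H` via `map_piXbar_eq_of_map_deltaX`, p429979).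
Plumbing (folklore): `map_conj_smul`, `map_subtype_conj_smul_subgroupOf`, `conj_smul_eq_self_of_normal`,
`conj_smul_eq_self_of_normal_subgroupOf`.  The assembly of Cor. 1.2 from these kernels is the companion
`PuncturedEllipticCoveringsCor12Assembly.lean`.  No side is taken on [IUTchIII] Cor. 3.12.
-/

namespace Literature.IUT.HodgeTheaters

namespace PuncturedEllipticData

open scoped Pointwise
open Literature.AnabelianGeometry.AbsoluteAnabelian

universe u

/-! ### Plumbing: conjugates of subgroups under homomorphisms and restrictions -/

section Plumbing

variable {G G' : Type*} [Group G] [Group G']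

/-- `f(t A t⁻¹) = f(t) f(A) f(t)⁻¹` (folklore; transport of conjugacy classes on p. 39).
[cite: Mochizuki2012, Cor 1.2 p.39] -/
theorem map_conj_smul (f : G →* G') (t : G) (A : Subgroup G) :
    (MulAut.conj t • A).map f = MulAut.conj (f t) • A.map f := by
  ext y
  simp only [Subgroup.mem_map, Subgroup.mem_smul_pointwise_iff_exists, MulAut.smul_def,
    MulAut.conj_apply]
  constructor
  · rintro ⟨x, ⟨a, ha, rfl⟩, rfl⟩
    exact ⟨f a, ⟨a, ha, rfl⟩, by rw [map_mul, map_mul, map_inv]⟩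
  · rintro ⟨_, ⟨a, ha, rfl⟩, rfl⟩
    exact ⟨t * a * t⁻¹, ⟨a, ha, rfl⟩, by rw [map_mul, map_mul, map_inv]⟩

/-- Pushing a conjugate inside `C` back into the ambient group: for `t ∈ C` and `A ≤ C`, the
subgroup `t (A ∩ C) t⁻¹` of `C` pushed into `G` is `t A t⁻¹` (folklore; p. 39's classes "in `Π_X̲`").
[cite: Mochizuki2012, Cor 1.2 p.39] -/
theorem map_subtype_conj_smul_subgroupOf {C : Subgroup G} (t : C) {A : Subgroup G} (hA : A ≤ C) :
    (MulAut.conj t • A.subgroupOf C).map C.subtype = MulAut.conj (t : G) • A := by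
  ext y
  simp only [Subgroup.mem_map, Subgroup.mem_smul_pointwise_iff_exists, MulAut.smul_def,
    MulAut.conj_apply, Subgroup.mem_subgroupOf, Subgroup.coe_subtype]
  constructor
  · rintro ⟨z, ⟨a, ha, rfl⟩, rfl⟩
    exact ⟨(a : G), ha, by simp only [Subgroup.coe_mul, Subgroup.coe_inv]⟩
  · rintro ⟨a, ha, rfl⟩
    exact ⟨t * ⟨a, hA ha⟩ * t⁻¹, ⟨⟨a, hA ha⟩, ha, rfl⟩, by
      simp only [Subgroup.coe_mul, Subgroup.coe_inv]⟩

/-- A normal subgroup is fixed by conjugation (folklore). [cite: Mochizuki2012, Cor 1.2 p.39] -/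
theorem conj_smul_eq_self_of_normal (N : Subgroup G) [hN : N.Normal] (g : G) :
    MulAut.conj g • N = N := by
  ext y
  rw [Subgroup.mem_smul_pointwise_iff_exists]
  constructor
  · rintro ⟨z, hz, rfl⟩
    rw [MulAut.smul_def, MulAut.conj_apply]
    exact hN.conj_mem z hz g
  · intro hy
    refine ⟨g⁻¹ * y * g⁻¹⁻¹, hN.conj_mem y hy g⁻¹, ?_⟩
    rw [MulAut.smul_def, MulAut.conj_apply]
    group

/-- A subgroup normal INSIDE `C` is fixed by conjugation by elements of `C` (folklore).
[cite: Mochizuki2012, Cor 1.2 p.39] -/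
theorem conj_smul_eq_self_of_normal_subgroupOf {C P : Subgroup G} (hP : P ≤ C)
    [hN : (P.subgroupOf C).Normal] {c : G} (hc : c ∈ C) : MulAut.conj c • P = P := by
  ext y
  rw [Subgroup.mem_smul_pointwise_iff_exists]
  constructor
  · rintro ⟨z, hz, rfl⟩
    rw [MulAut.smul_def, MulAut.conj_apply]
    have key := hN.conj_mem ⟨z, hP hz⟩ (Subgroup.mem_subgroupOf.mpr hz) ⟨c, hc⟩
    rw [Subgroup.mem_subgroupOf, Subgroup.coe_mul, Subgroup.coe_mul, Subgroup.coe_inv] at key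
    exact key
  · intro hy
    have key := hN.conj_mem ⟨y, hP hy⟩ (Subgroup.mem_subgroupOf.mpr hy) ⟨c⁻¹, C.inv_mem hc⟩
    rw [Subgroup.mem_subgroupOf, Subgroup.coe_mul, Subgroup.coe_mul, Subgroup.coe_inv] at key
    refine ⟨c⁻¹ * y * c⁻¹⁻¹, key, ?_⟩
    rw [MulAut.smul_def, MulAut.conj_apply]
    group

end Plumbing

variable {D D' : PuncturedEllipticData.{u}}

/-! ### `Π_X = Π_X̲ · Δ_X`, `[Π_C : Π_C̲] = l`, and their transport -/

/-- `Π_X = Π_X̲ · Δ_X` (UNCONDITIONAL: `Π_X̲ ⊇ D_{2ε} ↠ G_k`). ([IUTchI] §1 p.37)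
[claim: Mochizuki2012, status: disputed] -/
theorem piX_eq_piXbar_sup_deltaX (D : PuncturedEllipticData.{u}) :
    D.PiX = D.PiXbar ⊔ (D.PiX ⊓ D.DeltaC) := by
  have hle : D.PiXbar ≤ D.PiX := inf_le_left
  refine le_antisymm ?_ (sup_le hle inf_le_left)
  intro p hp
  obtain ⟨⟨d, hd⟩, hdp⟩ := D.aug_decomp_twoε (D.E.aug.toMonoidHom p)
  have hdp' : D.E.aug d = D.E.aug p := hdp
  have hq : d⁻¹ * p ∈ D.PiX ⊓ D.DeltaC := by
    refine ⟨D.PiX.mul_mem (D.PiX.inv_mem (D.decomp_le _ hd).1) hp, ?_⟩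
    show d⁻¹ * p ∈ D.E.geom
    rw [FundamentalExtension.mem_geom, map_mul, map_inv, hdp', inv_mul_cancel]
  rw [← mul_inv_cancel_left d p]
  exact Subgroup.mul_mem _ (Subgroup.mem_sup_left (D.decomp_le _ hd)) (Subgroup.mem_sup_right hq)

/-- Transport: `Θ(Π_X̲) = Π'_X̲` and `Θ(Δ_X) = Δ'_X` give `Θ(Π_X) = Π'_X`. ([IUTchI] Cor 1.2 p.39)
[claim: Mochizuki2012, status: disputed] -/
theorem map_piX_eq (Θ : D.PiC ≃* D'.PiC) (hΘXbar : D.PiXbar.map Θ.toMonoidHom = D'.PiXbar)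
    (hΘX : (D.PiX ⊓ D.DeltaC).map Θ.toMonoidHom = D'.PiX ⊓ D'.DeltaC) :
    D.PiX.map Θ.toMonoidHom = D'.PiX := by
  rw [D.piX_eq_piXbar_sup_deltaX, D'.piX_eq_piXbar_sup_deltaX, Subgroup.map_sup, hΘXbar, hΘX]

/-- `[Π_C : Π_C̲] = l` under the printed claims of p. 38 (`[Π_C̲ : Π_X̲] = 2`) and the law
`[Π_X : Π_X̲] = l` (with `[Π_C : Π_X] = 2`). ([IUTchI] Cor 1.2 p.39) [claim: Mochizuki2012, status: disputed] -/
theorem ArrowCoveringClaims.index_piCbar (h : D.ArrowCoveringClaims)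
    (hX : D.PiXbar.relIndex D.PiX = D.l) : D.PiCbar.index = D.l := by
  have hle : D.PiXbar ≤ D.PiX := inf_le_left
  have h1 : D.PiXbar.index = D.l * 2 := by
    rw [← Subgroup.relIndex_mul_index hle, hX, D.index_piX]
  have h2 : D.PiXbar.index = 2 * D.PiCbar.index := by
    rw [← Subgroup.relIndex_mul_index D.piXbar_le_piCbar, h.relIndex_piXbar]
  omega

/-- `Π_{X̲→}` is fixed by conjugation by `Π_C̲` (it is normal in `Π_C̲`, p. 38).
([IUTchI] §1 p.38) [claim: Mochizuki2012, status: disputed] -/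
theorem ArrowCoveringClaims.conj_smul_piXarrow (h : D.ArrowCoveringClaims) {c : D.PiC}
    (hc : c ∈ D.PiCbar) : MulAut.conj c • D.piXarrow = D.piXarrow :=
  haveI := h.piXarrow_normal
  conj_smul_eq_self_of_normal_subgroupOf D.piXarrow_le_piCbar hc

/-! ### The correspondence of cusps under `Θ`: `Θ(D_x) = t' · D'_{x'} · t'⁻¹`, `t' ∈ Π'_X̲` -/

/-- The correspondence is FUNCTIONAL: `x'` is determined by `x` (distinct cusps of `X̲'` have
non-`Π'_X̲`-conjugate decomposition groups). ([IUTchI] Cor 1.2 p.39) [claim: Mochizuki2012, status: disputed] -/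
theorem cusp_eq_of_map_decomp_eq (C' : D'.CuspGalois) (Θ : D.PiC ≃* D'.PiC) {x : D.Cusp}
    {x₁ x₂ : D'.Cusp} {t₁ t₂ : D'.PiC} (ht₁ : t₁ ∈ D'.PiXbar) (ht₂ : t₂ ∈ D'.PiXbar)
    (h₁ : (D.decomp x).map Θ.toMonoidHom = MulAut.conj t₁ • D'.decomp x₁)
    (h₂ : (D.decomp x).map Θ.toMonoidHom = MulAut.conj t₂ • D'.decomp x₂) : x₁ = x₂ := by
  refine C'.eq_of_conj x₁ x₂ (t₂⁻¹ * t₁) (D'.PiXbar.mul_mem (D'.PiXbar.inv_mem ht₂) ht₁) ?_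
  rw [map_mul, mul_smul, ← h₁, h₂, ← mul_smul, ← map_mul, inv_mul_cancel, map_one, one_smul]

/-- The correspondence is INJECTIVE (pull the conjugating element back through `Θ(Π_X̲) = Π'_X̲`).
([IUTchI] Cor 1.2 p.39) [claim: Mochizuki2012, status: disputed] -/
theorem cusp_eq_of_map_decomp_eq' (C : D.CuspGalois) (Θ : D.PiC ≃* D'.PiC)
    (hΘXbar : D.PiXbar.map Θ.toMonoidHom = D'.PiXbar) {x₁ x₂ : D.Cusp} {x' : D'.Cusp}
    {t₁ t₂ : D'.PiC} (ht₁ : t₁ ∈ D'.PiXbar) (ht₂ : t₂ ∈ D'.PiXbar)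
    (h₁ : (D.decomp x₁).map Θ.toMonoidHom = MulAut.conj t₁ • D'.decomp x')
    (h₂ : (D.decomp x₂).map Θ.toMonoidHom = MulAut.conj t₂ • D'.decomp x') : x₁ = x₂ := by
  have ht : t₂ * t₁⁻¹ ∈ D.PiXbar.map Θ.toMonoidHom := by
    rw [hΘXbar]; exact D'.PiXbar.mul_mem ht₂ (D'.PiXbar.inv_mem ht₁)
  obtain ⟨s, hs, hst⟩ := ht
  refine C.eq_of_conj x₁ x₂ s hs (Subgroup.map_injective (f := Θ.toMonoidHom) Θ.injective ?_)
  have e : Θ.toMonoidHom s * t₁ = t₂ := by rw [hst, inv_mul_cancel_right]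
  rw [map_conj_smul, h₁, h₂, ← mul_smul, ← map_mul, e]

/-- The correspondence INTERTWINES the cusp actions: if `Θ(D_x) ∼ D'_{x'}` then
`Θ(D_{g·x}) ∼ D'_{Θ(g)·x'}` for every `g ∈ Π_C` (`Π'_X̲ ⊴ Π'_C`). ([IUTchI] Cor 1.2 p.39)
[claim: Mochizuki2012, status: disputed] -/
theorem map_decomp_act (C : D.CuspGalois) (C' : D'.CuspGalois) (Θ : D.PiC ≃* D'.PiC)
    (hΘXbar : D.PiXbar.map Θ.toMonoidHom = D'.PiXbar) {x : D.Cusp} {x' : D'.Cusp} {t' : D'.PiC}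
    (ht' : t' ∈ D'.PiXbar) (hx : (D.decomp x).map Θ.toMonoidHom = MulAut.conj t' • D'.decomp x')
    (g : D.PiC) :
    ∃ t'' ∈ D'.PiXbar, (D.decomp (C.act g x)).map Θ.toMonoidHom =
      MulAut.conj t'' • D'.decomp (C'.act (Θ g) x') := by
  obtain ⟨t, ht, hconj⟩ := C.act_decomp g x
  obtain ⟨s, hs, hconj'⟩ := C'.act_decomp (Θ g) x'
  haveI := C'.normal_PiXbar
  refine ⟨Θ (t * g) * t' * (s * Θ g)⁻¹, ?_, ?_⟩
  · have hΘt : Θ t ∈ D'.PiXbar := by rw [← hΘXbar]; exact ⟨t, ht, rfl⟩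
    have e : Θ (t * g) * t' * (s * Θ g)⁻¹ = Θ t * (Θ g * t' * (Θ g)⁻¹) * s⁻¹ := by
      rw [map_mul]; group
    rw [e]
    exact D'.PiXbar.mul_mem (D'.PiXbar.mul_mem hΘt (‹D'.PiXbar.Normal›.conj_mem t' ht' (Θ g)))
      (D'.PiXbar.inv_mem hs)
  · have lhs : (D.decomp (C.act g x)).map Θ.toMonoidHom =
        MulAut.conj (Θ (t * g) * t') • D'.decomp x' := by
      rw [← hconj, map_conj_smul, hx, ← mul_smul, ← map_mul, MulEquiv.coe_toMonoidHom]
    have rhs : MulAut.conj (Θ (t * g) * t' * (s * Θ g)⁻¹) • D'.decomp (C'.act (Θ g) x') =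
        MulAut.conj (Θ (t * g) * t') • D'.decomp x' := by
      rw [← hconj', ← mul_smul, ← map_mul, inv_mul_cancel_right]
    rw [lhs, rhs]

/-- The correspondence respects the RAMIFICATION criterion "image in `Gal(X̲→/X̲)` nontrivial":
`I_x ⊆ Π_{X̲→} ↔ I'_{x'} ⊆ Π'_{X̲→}` whenever `Θ(Π_{X̲→}) = Π'_{X̲→}`, `Θ(Δ_C) = Δ'_C`
[`Θ(I_x) = t'·I'_{x'}·t'⁻¹` and `t' ∈ Π'_C̲` normalises `Π'_{X̲→}`]. ([IUTchI] Cor 1.2 p.39)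
[claim: Mochizuki2012, status: disputed] -/
theorem not_inertia_le_iff_of_map_decomp (h' : D'.ArrowCoveringClaims) (Θ : D.PiC ≃* D'.PiC)
    (hΘ : D.piXarrow.map Θ.toMonoidHom = D'.piXarrow) (hΘΔ : D.DeltaC.map Θ.toMonoidHom = D'.DeltaC)
    {x : D.Cusp} {x' : D'.Cusp} {t' : D'.PiC} (ht' : t' ∈ D'.PiXbar)
    (hx : (D.decomp x).map Θ.toMonoidHom = MulAut.conj t' • D'.decomp x') :
    (¬ D.inertia x ≤ D.piXarrow) ↔ ¬ D'.inertia x' ≤ D'.piXarrow := by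
  haveI := D'.E.normal_geom
  have hI : (D.inertia x).map Θ.toMonoidHom = MulAut.conj t' • D'.inertia x' := by
    rw [inertia, Subgroup.map_inf _ _ _ Θ.injective, hx, hΘΔ, inertia, Subgroup.smul_inf,
      DeltaC, conj_smul_eq_self_of_normal D'.E.geom t']
  refine not_congr ?_
  rw [← Subgroup.map_le_map_iff_of_injective (f := Θ.toMonoidHom) Θ.injective, hI, hΘ,
    Subgroup.pointwise_smul_subset_iff, ← map_inv,
    h'.conj_smul_piXarrow (D'.PiCbar.inv_mem (D'.piXbar_le_piCbar ht'))]

/-- Hence the correspondence respects the three RAMIFIED cusps `{ε⁰, ε′, ε″}` (given the printed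
clause `¬ I_{ε⁰} ⊆ Π_{X̲→}` on both sides and the frozen claims for `ε′, ε″`).
([IUTchI] Cor 1.2 p.39) [claim: Mochizuki2012, status: disputed] -/
theorem mem_triple_iff_of_map_decomp (h : D.ArrowCoveringClaims) (h' : D'.ArrowCoveringClaims)
    (Θ : D.PiC ≃* D'.PiC) (hΘ : D.piXarrow.map Θ.toMonoidHom = D'.piXarrow)
    (hΘΔ : D.DeltaC.map Θ.toMonoidHom = D'.DeltaC) (h0 : ¬ D.inertia D.ε0 ≤ D.piXarrow)
    (h0' : ¬ D'.inertia D'.ε0 ≤ D'.piXarrow) {x : D.Cusp} {x' : D'.Cusp} {t' : D'.PiC}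
    (ht' : t' ∈ D'.PiXbar) (hx : (D.decomp x).map Θ.toMonoidHom = MulAut.conj t' • D'.decomp x') :
    x ∈ ({D.ε0, D.ε1, D.ε2} : Set D.Cusp) ↔ x' ∈ ({D'.ε0, D'.ε1, D'.ε2} : Set D'.Cusp) := by
  have key : ∀ (E : PuncturedEllipticData.{u}), E.ArrowCoveringClaims →
      ¬ E.inertia E.ε0 ≤ E.piXarrow → ∀ y : E.Cusp,
        y ∈ ({E.ε0, E.ε1, E.ε2} : Set E.Cusp) ↔ ¬ E.inertia y ≤ E.piXarrow := by
    intro E hE hE0 y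
    by_cases hy : y = E.ε0
    · subst hy
      exact iff_of_true (by simp) hE0
    · rw [hE.not_inertia_le_piXarrow_iff hy]
      simp only [Set.mem_insert_iff, Set.mem_singleton_iff, hy, false_or]
  rw [key D h h0 x, key D' h' h0' x']
  exact not_inertia_le_iff_of_map_decomp h' Θ hΘ hΘΔ ht' hx

/-! ### `Θ(Π_C̲) = Π'_C̲` by the splitting step -/

/-- **`Θ(Π_C̲) = Π'_C̲`.**  For data satisfying the printed claims of p. 38, the cusp actions, the law
`[Π_X : Π_X̲] = l` and the printed clause `¬ I_{ε⁰} ⊆ Π_{X̲→}` (both sides), a bicontinuous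
`Θ : Π_C ⥲ Π'_C` carrying `Π_{X̲→}, Δ_X, Δ_C` onto their counterparts and INDUCING a correspondence of
cusps (every cusp of `X̲'` has a decomposition group `Π'_X̲`-conjugate to some `Θ(D_x)`) carries `Π_C̲`
onto `Π'_C̲`: an element of `Θ(Π_C̲) ∖ Π'_X` stabilises `{ε⁰', ε′', ε″'}`, hence lies in `Π'_C̲` by
"the unique splitting that stabilizes …" (`mem_piCbar_of_act_stabilizes`), and `[Π_C : Π_C̲] = l = l'
= [Π'_C : Π'_C̲]`. ([IUTchI] Cor 1.2 p.39) [claim: Mochizuki2012, status: disputed] -/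
theorem ArrowCoveringClaims.map_piCbar_eq_of_cusps (h : D.ArrowCoveringClaims)
    (h' : D'.ArrowCoveringClaims) (C : D.CuspGalois) (C' : D'.CuspGalois)
    (hX : D.PiXbar.relIndex D.PiX = D.l) (hX' : D'.PiXbar.relIndex D'.PiX = D'.l)
    (h0 : ¬ D.inertia D.ε0 ≤ D.piXarrow) (h0' : ¬ D'.inertia D'.ε0 ≤ D'.piXarrow)
    (Θ : D.PiC ≃* D'.PiC) (hc : Continuous Θ) (hc' : Continuous Θ.symm)
    (hΘ : D.piXarrow.map Θ.toMonoidHom = D'.piXarrow)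
    (hΘX : (D.PiX ⊓ D.DeltaC).map Θ.toMonoidHom = D'.PiX ⊓ D'.DeltaC)
    (hΘΔ : D.DeltaC.map Θ.toMonoidHom = D'.DeltaC)
    (hcusp' : ∀ x' : D'.Cusp, ∃ x : D.Cusp, ∃ t' ∈ D'.PiXbar,
      (D.decomp x).map Θ.toMonoidHom = MulAut.conj t' • D'.decomp x') :
    D.PiCbar.map Θ.toMonoidHom = D'.PiCbar := by
  have hl : D.l = D'.l := h.l_eq_of_map_deltaC h' hX hX' Θ hΘ hΘΔ
  have hΘXbar : D.PiXbar.map Θ.toMonoidHom = D'.PiXbar :=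
    h.map_piXbar_eq_of_map_deltaX h' C C' hX hX' Θ hc hc' hΘ hΘX hΘΔ
  have hΘPiX : D.PiX.map Θ.toMonoidHom = D'.PiX := map_piX_eq Θ hΘXbar hΘX
  have hcard' : Nat.card D'.Cusp = D'.l := C'.card_cusp.trans hX'
  -- `Θ(Π_C̲) ⊆ Π'_C̲`
  have hle : D.PiCbar.map Θ.toMonoidHom ≤ D'.PiCbar := by
    rintro _ ⟨s, hs, rfl⟩
    by_cases hsX : s ∈ D.PiX
    · have hmem : Θ.toMonoidHom s ∈ D'.PiXbar := by rw [← hΘXbar]; exact ⟨s, ⟨hsX, hs⟩, rfl⟩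
      exact hmem.2
    · have hsX' : Θ.toMonoidHom s ∉ D'.PiX := by
        rw [← hΘPiX]
        rintro ⟨r, hr, hrs⟩
        exact hsX (Θ.injective hrs ▸ hr)
      refine h'.mem_piCbar_of_act_stabilizes C' hcard' hsX' fun x' hx' => ?_
      obtain ⟨x, t', ht', hxx'⟩ := hcusp' x'
      have hxT : x ∈ ({D.ε0, D.ε1, D.ε2} : Set D.Cusp) :=
        (mem_triple_iff_of_map_decomp h h' Θ hΘ hΘΔ h0 h0' ht' hxx').mpr hx'
      obtain ⟨t'', ht'', hgx⟩ := map_decomp_act C C' Θ hΘXbar ht' hxx' s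
      exact (mem_triple_iff_of_map_decomp h h' Θ hΘ hΘΔ h0 h0' ht'' hgx).mp
        (C.act_mem_triple_of_mem_piCbar hs hxT)
  -- equality by the index `[Π_C : Π_C̲] = l = l'`
  refine le_antisymm hle (Subgroup.relIndex_eq_one.mp ?_)
  have hidx : (D.PiCbar.map Θ.toMonoidHom).index = D'.PiCbar.index := by
    rw [Subgroup.index_map_of_bijective (f := Θ.toMonoidHom) Θ.bijective, h.index_piCbar hX,
      h'.index_piCbar hX', hl]
  have hne : D'.PiCbar.index ≠ 0 := by
    rw [h'.index_piCbar hX']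
    have := D'.five_le
    omega
  have h1 := Subgroup.relIndex_mul_index hle
  rw [hidx] at h1
  exact Nat.eq_of_mul_eq_mul_right (Nat.pos_of_ne_zero hne) (h1.trans (one_mul _).symm)


end PuncturedEllipticData

end Literature.IUT.HodgeTheaters
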